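import Summits.HubbardSuperconductivity.HubbardSuperconductivity.Theorems.AnisotropyChordTransferFibre3PoleCount
import Summits.HubbardSuperconductivity.HubbardSuperconductivity.Theorems.AnisotropyChordTransferFibre3KernelHarmonicity
import Summits.HubbardSuperconductivity.HubbardSuperconductivity.Theorems.AnisotropyChordTransferFibre3TtailBounds
import Summits.HubbardSuperconductivity.HubbardSuperconductivity.Theorems.AnisotropyChordTransferFibre3TwoMagnonQF
import Summits.HubbardSuperconductivity.HubbardSuperconductivity.Theorems.AnisotropyChordTransferFibre3OneLoopCross

/-!
# Route `AnisotropyChord` / H0 rotor rung: the DIRICHLET DUAL BOUND on the torus — one-body Fourier layer for PROP BS (HOLE₂ ⟸ finite Birman–Schwinger certificate)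

First of two files proving PROP BS (memo ROTOR-THEORY-19 §253, memo 21 §314(a) «EXACT REWRITE»; theory seat
`hubbard-h0-rotor-theory-1`): the two-hole Poincaré constant `TwoHoleGap L g` (`…Fibre3LemmaVTargets`, PORT PartN36 — the
one-body spectral input HOLE₂(.75) = `TwoHoleGap L (3/4·ε₁)` of the GM₃ ∀L assembly `gm3_of_hole2`) follows from a FINITE
positivity certificate on the ten points `ζ ∪ ∂ζ` built from the torus Green's function.  Nothing in the tree connected
`TwoHoleGap` with the Birman–Schwinger matrices of PartN37/39/40 before; this layer and `…Fibre3TwoHoleBS` supply the link.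

This file (rate-½ walk on `(ℤ/L)²`, symbol `ε(k) = 2 − cos kₓ − cos k_y`, so «no hole» has Poincaré constant `ε₁`):
* `ft` (one-body Fourier transform), `dirichletW` (`E[f] = ¼Σ_xΣ_e‖f x − f(x+e)‖²`), `greenW`
  (`G̃_g(r) = (1/V)Σ_{k≠0} e^{ik·r}/(ε(k) − g)`, zero mode removed), `greenQF` (`Γ_g(c) = Σ conj(c x) G̃_g(x−y) c y`);
* Parseval bookkeeping: `dirichletW_eq` (`E[f] = (1/V)Σ ε(k)‖f̂‖²`), `sum_norm_sq`, `inner_eq`, `greenQF_eq`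
  (`Γ_g(c) = (1/V)Σ_{k≠0}‖ĉ‖²/(ε(k) − g)`), `ft_shift`, `ft_zero`;
* ★ `dual_bound` — the LEGENDRE FORM OF THE DIRICHLET PRINCIPLE: for `g < ε₁`, `Σf = 0` and ANY charge `c`,
  `2Re⟨c,f⟩ − Re Γ_g(c) ≤ E[f] − g‖f‖²` (termwise `‖(ε−g)f̂ − ĉ‖² ≥ 0`; the zero mode drops because `f̂(0) = Σf = 0`);
* identification with the tree's KT-normalised kernel of PartN37: `greenW_im = 0`, `greenW_re = 2·Gres L (2g)`,
  `greenW_diff_re`: `G̃_g(0) − G̃_g(r) = 2·aKer L (2g) r` (walk units; at `g = ¾ε₁` this is PartN37 v2's `aWalk`).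
Prover seat `hubbard-h0-rotor-p2` g2; helper for stmt-HubbardSuperconductivity-19089 (`--supports`, helper class).
WHAT THIS IS NOT: nothing here proves superconductivity in the Hubbard model; the rotor TARGET as originally worded stays
FALSE (g15 verdict) — this is one-body Fourier bookkeeping for ONE conditional reduction (rung 19089, HOLE₂ chain).
Mathlib + tree imports only; no sorry, no axioms.
-/

set_option linter.dupNamespace false

noncomputable section

open scoped BigOperators
open Complex Finset

namespace Summit.HubbardSuperconductivity.HubbardSuperconductivity.Theorems.AnisotropyChord.Transfer.Fibre3

namespace TwoHoleBS

variable (L : ℕ) [NeZero L]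

/-! ## One-body Fourier layer on the torus `(ℤ/L)²` -/

/-- one-body Fourier transform `f̂(k) = Σ_x conj φ_k(x) · f(x)`. [folklore] -/
def ft (f : Tor L → ℂ) (k : Tor L) : ℂ := ∑ x : Tor L, (starRingEnd ℂ) (phase L k x) * f x

/-- Dirichlet form of the rate-½ walk, `E[f] = ¼ Σ_x Σ_e ‖f x − f(x+e)‖²` (ordered bonds, weight ¼). [folklore] -/
def dirichletW (f : Tor L → ℂ) : ℝ :=
  (1 / 4 : ℝ) * ∑ x : Tor L, ((nnList L).map (fun e => ‖f x - f (x + e)‖ ^ 2)).sum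

/-- zero-mode-removed Green's function of `L_w − g` in complex form, `G̃_g(r) = (1/V) Σ_{k≠0} φ_k(r)/(ε(k) − g)`
(real-valued: `= 2·Gres L (2g) r`, see `greenW_re`, `greenW_im`). [folklore] -/
def greenW (g : ℝ) (r : Tor L) : ℂ :=
  (∑ k : Tor L, if k = 0 then (0 : ℂ) else phase L k r / ((epsT L k - g : ℝ) : ℂ)) / ((L : ℂ) ^ 2)

/-- the Green quadratic form of a charge `c`: `Γ_g(c) = Σ_{x,y} conj(c x) G̃_g(x − y) c(y)`. [folklore] -/
def greenQF (g : ℝ) (c : Tor L → ℂ) : ℂ :=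
  ∑ x : Tor L, ∑ y : Tor L, (starRingEnd ℂ) (c x) * greenW L g (x - y) * c y

omit [NeZero L] in
/-- real part of a quotient by `V`. [folklore] -/
theorem div_V_re (z : ℂ) : (z / (L : ℂ) ^ 2).re = z.re / (L : ℝ) ^ 2 := by
  rw [Vsq_cast, Complex.div_ofReal_re]

/-- `f̂(0) = Σ_x f x`. [folklore] -/
theorem ft_zero (f : Tor L → ℂ) : ft L f 0 = ∑ x : Tor L, f x := by
  unfold ft
  refine Finset.sum_congr rfl fun x _ => ?_
  rw [phase_zero_left, map_one, one_mul]

/-- shift rule `(f(· + e))^(k) = φ_k(e) f̂(k)`. [folklore] -/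
theorem ft_shift (f : Tor L → ℂ) (e k : Tor L) :
    ft L (fun x => f (x + e)) k = phase L k e * ft L f k := by
  unfold ft
  have hpt : ∀ x : Tor L, (starRingEnd ℂ) (phase L k x) * f (x + e)
      = phase L k e * ((starRingEnd ℂ) (phase L k (x + e)) * f (x + e)) := by
    intro x
    rw [conj_phase, conj_phase, ← mul_assoc, ← phase_add]
    congr 2
    abel
  rw [Finset.sum_congr rfl fun x _ => hpt x, ← Finset.mul_sum]
  congr 1
  have := Equiv.sum_comp (Equiv.addRight e) (fun y => (starRingEnd ℂ) (phase L k y) * f y)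
  simpa using this

/-- `‖1 − φ_k(e)‖² = 2(1 − Re φ_k(e))`. [folklore] -/
theorem norm_one_sub_phase_sq (k e : Tor L) : ‖1 - phase L k e‖ ^ 2 = 2 * (1 - (phase L k e).re) := by
  have h := normSq_phase L k e
  rw [Complex.normSq_apply] at h
  rw [Complex.sq_norm, Complex.normSq_apply]
  simp only [Complex.sub_re, Complex.one_re, Complex.sub_im, Complex.one_im]
  linear_combination h

/-- Parseval for one difference: `Σ_x ‖f x − f(x+e)‖² = (1/V) Σ_k 2(1 − Re φ_k(e)) ‖f̂(k)‖²`. [folklore] -/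
theorem sum_sq_shift (f : Tor L → ℂ) (e : Tor L) :
    ∑ x : Tor L, ‖f x - f (x + e)‖ ^ 2
      = (∑ k : Tor L, 2 * (1 - (phase L k e).re) * ‖ft L f k‖ ^ 2) / (L : ℝ) ^ 2 := by
  have hP := parseval1D L (fun x => f x - f (x + e))
  have hV : (0 : ℝ) < (L : ℝ) ^ 2 := by
    have : (0 : ℝ) < (L : ℝ) := Nat.cast_pos.mpr (Nat.pos_of_ne_zero (NeZero.ne L))
    positivity
  rw [eq_div_iff hV.ne', mul_comm, ← hP]
  refine Finset.sum_congr rfl fun k _ => ?_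
  have : ∑ b : Tor L, (starRingEnd ℂ) (phase L k b) * (f b - f (b + e)) = (1 - phase L k e) * ft L f k := by
    simp only [mul_sub, Finset.sum_sub_distrib]
    change ft L f k - ft L (fun x => f (x + e)) k = _
    rw [ft_shift]
    ring
  rw [this, norm_mul, mul_pow, norm_one_sub_phase_sq]

/-- **Dirichlet form in Fourier space:** `E[f] = (1/V) Σ_k ε(k) ‖f̂(k)‖²`. [folklore] -/
theorem dirichletW_eq (f : Tor L → ℂ) :
    dirichletW L f = (∑ k : Tor L, epsT L k * ‖ft L f k‖ ^ 2) / (L : ℝ) ^ 2 := by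
  have hV : (0 : ℝ) < (L : ℝ) ^ 2 := by
    have : (0 : ℝ) < (L : ℝ) := Nat.cast_pos.mpr (Nat.pos_of_ne_zero (NeZero.ne L))
    positivity
  unfold dirichletW
  simp_rw [nnList_map_sum]
  simp only [Finset.sum_add_distrib]
  rw [sum_sq_shift, sum_sq_shift, sum_sq_shift, sum_sq_shift]
  rw [← add_div, ← add_div, ← add_div, ← Finset.sum_add_distrib, ← Finset.sum_add_distrib,
    ← Finset.sum_add_distrib, mul_div_assoc', div_left_inj' hV.ne', Finset.mul_sum]
  refine Finset.sum_congr rfl fun k _ => ?_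
  rw [phase_re_neg, phase_re_neg, epsT_eq_re]
  ring

/-- Parseval: `Σ_x ‖f x‖² = (1/V) Σ_k ‖f̂(k)‖²`. [folklore] -/
theorem sum_norm_sq (f : Tor L → ℂ) :
    ∑ x : Tor L, ‖f x‖ ^ 2 = (∑ k : Tor L, ‖ft L f k‖ ^ 2) / (L : ℝ) ^ 2 := by
  have hV : (0 : ℝ) < (L : ℝ) ^ 2 := by
    have : (0 : ℝ) < (L : ℝ) := Nat.cast_pos.mpr (Nat.pos_of_ne_zero (NeZero.ne L))
    positivity
  rw [eq_div_iff hV.ne', mul_comm]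
  exact (parseval1D L f).symm

/-- Plancherel (polarised): `Σ_x conj(c x) f x = (1/V) Σ_k conj(ĉ(k)) f̂(k)`. [folklore] -/
theorem inner_eq (c f : Tor L → ℂ) :
    ∑ x : Tor L, (starRingEnd ℂ) (c x) * f x
      = (∑ k : Tor L, (starRingEnd ℂ) (ft L c k) * ft L f k) / (L : ℂ) ^ 2 := by
  have hV : ((L : ℂ) ^ 2) ≠ 0 := pow_ne_zero 2 (by exact_mod_cast (NeZero.ne L))
  rw [eq_div_iff hV]
  unfold ft
  have hX : ∀ k : Tor L, (starRingEnd ℂ) (∑ x : Tor L, (starRingEnd ℂ) (phase L k x) * c x)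
        * (∑ y : Tor L, (starRingEnd ℂ) (phase L k y) * f y)
      = ∑ x : Tor L, ∑ y : Tor L, (starRingEnd ℂ) (c x) * f y * phase L k (x - y) := by
    intro k
    rw [map_sum, Finset.sum_mul_sum]
    refine Finset.sum_congr rfl fun x _ => Finset.sum_congr rfl fun y _ => ?_
    rw [map_mul, Complex.conj_conj, conj_phase, sub_eq_add_neg, phase_add]
    ring
  rw [Finset.sum_congr rfl fun k _ => hX k, Finset.sum_comm]
  rw [Finset.sum_mul]
  refine Finset.sum_congr rfl fun x _ => ?_
  rw [Finset.sum_comm]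
  have hq : ∀ y : Tor L, ∑ k : Tor L, (starRingEnd ℂ) (c x) * f y * phase L k (x - y)
      = if x = y then (starRingEnd ℂ) (c x) * f y * (L : ℂ) ^ 2 else 0 := by
    intro y
    rw [← Finset.mul_sum, sum_phase_left]
    by_cases h : x = y
    · simp [h]
    · have h' : x - y ≠ 0 := sub_ne_zero.mpr h
      simp [h, h']
  rw [Finset.sum_congr rfl fun y _ => hq y, Finset.sum_ite_eq]
  simp

/-- `conj(ĉ(k))·ĉ(k)` written with the two character sums. [folklore] -/
theorem conj_ft_mul_ft (c : Tor L → ℂ) (k : Tor L) :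
    (∑ x : Tor L, (starRingEnd ℂ) (c x) * phase L k x) * (∑ y : Tor L, (starRingEnd ℂ) (phase L k y) * c y)
      = (((‖ft L c k‖ ^ 2 : ℝ)) : ℂ) := by
  rw [Complex.ofReal_pow, ← Complex.conj_mul']
  unfold ft
  rw [map_sum]
  congr 1
  refine Finset.sum_congr rfl fun x _ => ?_
  rw [map_mul, Complex.conj_conj, mul_comm]

/-- **the Green quadratic form in Fourier space:** `Γ_g(c) = (1/V) Σ_{k≠0} ‖ĉ(k)‖²/(ε(k) − g)`. [folklore] -/
theorem greenQF_eq (g : ℝ) (c : Tor L → ℂ) :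
    greenQF L g c
      = (∑ k : Tor L, if k = 0 then (0 : ℂ)
          else (((‖ft L c k‖ ^ 2 / (epsT L k - g) : ℝ)) : ℂ)) / (L : ℂ) ^ 2 := by
  unfold greenQF greenW
  have h1 : ∀ x y : Tor L, (starRingEnd ℂ) (c x)
        * ((∑ k : Tor L, if k = 0 then (0 : ℂ) else phase L k (x - y) / ((epsT L k - g : ℝ) : ℂ)) / (L : ℂ) ^ 2)
        * c y
      = (∑ k : Tor L, if k = 0 then (0 : ℂ)
          else ((starRingEnd ℂ) (c x) * phase L k x) * ((starRingEnd ℂ) (phase L k y) * c y)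
            / ((epsT L k - g : ℝ) : ℂ)) / (L : ℂ) ^ 2 := by
    intro x y
    rw [mul_div_assoc', div_mul_eq_mul_div, Finset.mul_sum, Finset.sum_mul]
    congr 1
    refine Finset.sum_congr rfl fun k _ => ?_
    split_ifs with hk
    · simp
    · rw [conj_phase, sub_eq_add_neg, phase_add]
      ring
  simp_rw [h1]
  simp only [← Finset.sum_div]
  congr 1
  rw [Finset.sum_congr rfl fun x _ => Finset.sum_comm, Finset.sum_comm]
  refine Finset.sum_congr rfl fun k _ => ?_
  by_cases hk : k = 0
  · simp [hk]
  · simp only [hk, if_false]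
    simp only [← Finset.sum_div]
    rw [← Finset.sum_mul_sum, conj_ft_mul_ft, ← Complex.ofReal_div]

/-- termwise completion of the square: `2 Re(conj v · u) − ‖v‖²/a ≤ a ‖u‖²` for `a > 0`. [folklore] -/
theorem termwise {a : ℝ} (ha : 0 < a) (u v : ℂ) :
    2 * ((starRingEnd ℂ) v * u).re - ‖v‖ ^ 2 / a ≤ a * ‖u‖ ^ 2 := by
  have hu : ‖u‖ ^ 2 = u.re ^ 2 + u.im ^ 2 := by rw [Complex.sq_norm, Complex.normSq_apply]; ring
  have hv : ‖v‖ ^ 2 = v.re ^ 2 + v.im ^ 2 := by rw [Complex.sq_norm, Complex.normSq_apply]; ring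
  have hre : ((starRingEnd ℂ) v * u).re = v.re * u.re + v.im * u.im := by
    simp only [Complex.mul_re, Complex.conj_re, Complex.conj_im]; ring
  have key : 0 ≤ (a * u.re - v.re) ^ 2 + (a * u.im - v.im) ^ 2 := by positivity
  have h : 2 * (v.re * u.re + v.im * u.im) - a * (u.re ^ 2 + u.im ^ 2) ≤ (v.re ^ 2 + v.im ^ 2) / a := by
    rw [le_div_iff₀ ha]; nlinarith [key]
  rw [hu, hv, hre]; linarith

/-- **DIRICHLET DUAL BOUND (Legendre form of the Dirichlet principle on the torus):** for `g < ε₁`, a mean-zero `f` and ANY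
charge `c`, `2 Re⟨c,f⟩ − Re Γ_g(c) ≤ E[f] − g‖f‖²` (termwise `‖(ε−g)f̂ − ĉ‖² ≥ 0` after Parseval; the zero mode drops by
`f̂(0) = Σf = 0`). [folklore] -/
theorem dual_bound (hL : 2 ≤ L) {g : ℝ} (hg : g < eps1 L) (f c : Tor L → ℂ) (hf : ∑ x : Tor L, f x = 0) :
    2 * (∑ x : Tor L, (starRingEnd ℂ) (c x) * f x).re - (greenQF L g c).re
      ≤ dirichletW L f - g * ∑ x : Tor L, ‖f x‖ ^ 2 := by
  have hV : (0 : ℝ) < (L : ℝ) ^ 2 := by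
    have : (0 : ℝ) < (L : ℝ) := Nat.cast_pos.mpr (Nat.pos_of_ne_zero (NeZero.ne L))
    positivity
  rw [dirichletW_eq, sum_norm_sq, inner_eq, greenQF_eq, div_V_re, div_V_re, Complex.re_sum, Complex.re_sum,
    mul_div_assoc', mul_div_assoc', ← sub_div, ← sub_div, div_le_div_iff_of_pos_right hV, Finset.mul_sum,
    Finset.mul_sum, ← Finset.sum_sub_distrib, ← Finset.sum_sub_distrib]
  refine Finset.sum_le_sum fun k _ => ?_
  by_cases hk : k = 0
  · subst hk
    rw [ft_zero L f, hf]
    simp [epsT_zero]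
  · have ha : 0 < epsT L k - g := by have := eps1_le_epsT L hL hk; linarith
    rw [if_neg hk, Complex.ofReal_re]
    have := termwise ha (ft L f k) (ft L c k)
    linarith

/-! ## Identification with the tree's torus kernel (`Gres`, `aKer` of PartN37; walk units `= 2·KT units`) -/

/-- `G̃_g` is real: `Im G̃_g(r) = 0` (pair `k ↔ −k`). [folklore] -/
theorem greenW_im (g : ℝ) (r : Tor L) : (greenW L g r).im = 0 := by
  unfold greenW
  rw [Vsq_cast, Complex.div_ofReal_im, Complex.im_sum]
  have hneg : ∀ k : Tor L, (if -k = 0 then (0 : ℂ) else phase L (-k) r / ((epsT L (-k) - g : ℝ) : ℂ)).im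
      = -(if k = 0 then (0 : ℂ) else phase L k r / ((epsT L k - g : ℝ) : ℂ)).im := by
    intro k
    by_cases hk : k = 0
    · simp [hk]
    · have hk' : -k ≠ 0 := fun h => hk (neg_eq_zero.mp h)
      rw [if_neg hk, if_neg hk', epsT_neg, phase_neg_left, ← conj_phase, Complex.div_ofReal_im,
        Complex.div_ofReal_im, Complex.conj_im, neg_div]
  have hS := Equiv.sum_comp (Equiv.neg (Tor L))
    (fun k => (if k = 0 then (0 : ℂ) else phase L k r / ((epsT L k - g : ℝ) : ℂ)).im)
  simp only [Equiv.neg_apply, hneg, Finset.sum_neg_distrib] at hS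
  have : ∑ k : Tor L, (if k = 0 then (0 : ℂ) else phase L k r / ((epsT L k - g : ℝ) : ℂ)).im = 0 := by linarith
  rw [this, zero_div]

/-- `Re G̃_g(r) = 2 · Gres L (2g) r` (the tree's KT-normalised torus kernel; no hypothesis on `g`). [folklore] -/
theorem greenW_re (g : ℝ) (r : Tor L) : (greenW L g r).re = 2 * Gres L (2 * g) r := by
  unfold greenW Gres
  rw [div_V_re, Complex.re_sum, mul_div_assoc', Finset.mul_sum]
  congr 1
  refine Finset.sum_congr rfl fun k _ => ?_
  unfold gres
  by_cases hk : k = 0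
  · simp [hk]
  · rw [if_neg hk, if_neg hk, Complex.div_ofReal_re]
    by_cases hd : epsT L k - g = 0
    · have : 2 * epsT L k - 2 * g = 0 := by linarith
      rw [hd, this]; simp
    · have hd' : 2 * epsT L k - 2 * g ≠ 0 := fun h => hd (by linarith)
      field_simp

/-- the walk kernel differences: `Re(G̃_g(0) − G̃_g(r)) = 2 · aKer L (2g) r`; at the HOLE₂(.75) point `g = ¾ε₁` this is
PartN37's `aWalk` (`2·aKer L (3/2·ε₁)`). [folklore] -/
theorem greenW_diff_re (g : ℝ) (r : Tor L) :
    (greenW L g 0).re - (greenW L g r).re = 2 * aKer L (2 * g) r := by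
  rw [greenW_re, greenW_re]; unfold aKer; ring

end TwoHoleBS

end Summit.HubbardSuperconductivity.HubbardSuperconductivity.Theorems.AnisotropyChord.Transfer.Fibre3

end
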